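import Mathlib
import Summits.NavierStokesRegularity.NavierStokesRegularity.Theorems.FilamentSkeletonRssClause13TransportAveragingVar
import Summits.NavierStokesRegularity.NavierStokesRegularity.Theorems.FilamentSkeletonRssClause13WaistFence

/-!
# Clause 13-J/13-R, brick m3b-V (POINTWISE TRANSPORT CHAIN WITH VARIABLE COEFFICIENTS): waist start and weighted amplified zone for
# `w·z′ = iG z + α(τ) z + β(τ) z̄ + f`

Route `FilamentSkeletonRss`, ∃-side clause 13 (`Clause13RNearStraightL`, stmt-NavierStokesRegularity-23612; typing-agnostic).  Design of record
rev 80 / tenure note R-m3b-2.  `…Clause13WaistFence` (p713320) and `…Clause13WeightedFence` (p713880) do the frozen-coefficient case; the model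
operator has multipliers `β₁(τ), β₂(τ)` (and the damping margin `Re α = β̄(τ)` changes sign at the crossover radius), so the chain is restated
here over the landed variable-coefficient normal form `farBranch_norm_le_of_damped_var` (`…Clause13TransportAveragingVar`):
* §1 `waist_norm_le_of_damped_var` — damped zone started AT the stagnation point `w(c) = 0` with `α, β` functions (`β ∈ C¹`, `‖β‖ ≤ βmax ≤ G`),
  pointwise J-averaged damping margin including the variation term `(w‖β′‖/(2G))/(1−k)`, and `β₀ ≤ G − ‖α c‖ − ‖β c‖` at the waist;
* §2 `farBranch_norm_le_weighted_var` — amplified zone outward with the weight `((τ−c)/(a−c))^{−p}`, the pointwise condition being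
  `Re α(τ) + β₀ + (k/(1−k))(2|Im α(τ)| + k‖β τ‖) + (w‖β′‖/(2G))/(1−k) ≤ p·w₁` where `w ≥ w₁(τ−c)`.
(Mirror statements left of the waist follow by `τ ↦ 2c − τ` exactly as in the frozen files.)
Lane ns-filament-19175-p1 g17; `--supports stmt-NavierStokesRegularity-23612 --as helper`.
HONEST FRAMING: ODE lemmas for the bookkeeping of a HYPOTHETICAL filament skeleton on the NEGATIVE side of a MODEL route; nothing here bears on
Navier–Stokes regularity or blow-up.
-/

noncomputable section

open scoped InnerProductSpace ComplexConjugate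
open Set Complex MeasureTheory Filter Topology

namespace Summit.NavierStokesRegularity.NavierStokesRegularity.Theorems.Clause13Transport
set_option linter.dupNamespace false

/-! ## §0 The phase on a closed interval where `w > 0` -/

/-- The phase on `[a, b]`: if `w` is continuous and positive on `[a, b]` then `θ(r) = ∫_a^r G/w` has `θ′ = G/w` there. [folklore] -/
theorem hasDerivAt_phase_integral {w : ℝ → ℝ} {a b G : ℝ} (hwcont : Continuous w) (hwpos : ∀ t ∈ Icc a b, 0 < w t) :
    ∀ t ∈ Icc a b, HasDerivAt (fun r => ∫ s in a..r, G / w s) (G / w t) t := by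
  intro t ht
  have hUopen : IsOpen {s : ℝ | 0 < w s} := isOpen_lt continuous_const hwcont
  have hcontU : ContinuousOn (fun s => G / w s) {s : ℝ | 0 < w s} :=
    continuousOn_const.div hwcont.continuousOn fun s hs => ne_of_gt hs
  have htU : t ∈ {s : ℝ | 0 < w s} := hwpos t ht
  refine intervalIntegral.integral_hasDerivAt_right ?_ (hcontU.stronglyMeasurableAtFilter hUopen t htU)
    (hcontU.continuousAt (hUopen.mem_nhds htU))
  refine ContinuousOn.intervalIntegrable (hcontU.mono fun s hs => ?_)
  rw [uIcc_of_le ht.1] at hs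
  exact hwpos s ⟨hs.1, hs.2.trans ht.2⟩

/-! ## §1 The damped zone started at the waist, variable coefficients -/

/-- ★ **DAMPED TRANSPORT FROM THE STAGNATION POINT, variable `α(τ), β(τ)`.**  `w·z′ = iG z + α z + β z̄ + f` on `[c, b]`, `w` continuous,
`w(c) = 0`, `w > 0` on `(c, b]`, `β ∈ C¹` with `‖β‖ ≤ βmax ≤ G`, `‖f‖ ≤ M`; pointwise J-averaged damping
`β₀ ≤ −Re α(τ) − (k/(1−k))(2|Im α(τ)| + k‖β τ‖) − (w τ‖β′ τ‖/(2G))/(1−k)` (`k = βmax/(2G)`) and `β₀ ≤ G − ‖α c‖ − ‖β c‖`.  Then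
`‖z τ‖ ≤ ((1+k)M/β₀)/(1−k)` on `[c, b]`. [folklore] -/
theorem waist_norm_le_of_damped_var {z z' f α β β' : ℝ → ℂ} {w : ℝ → ℝ} {c b G M β₀ βmax : ℝ}
    (hG : 0 < G) (hM : 0 ≤ M) (hβ₀ : 0 < β₀) (hβmax0 : 0 ≤ βmax)
    (hz : ∀ τ ∈ Icc c b, HasDerivAt z (z' τ) τ) (hβ : ∀ τ ∈ Icc c b, HasDerivAt β (β' τ) τ)
    (hwcont : Continuous w) (hwc : w c = 0) (hw : ∀ τ ∈ Ioc c b, 0 < w τ)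
    (hode : ∀ τ ∈ Icc c b, (w τ : ℂ) * z' τ = I * G * z τ + α τ * z τ + β τ * conj (z τ) + f τ)
    (hf : ∀ τ ∈ Icc c b, ‖f τ‖ ≤ M) (hβmax : ∀ τ ∈ Icc c b, ‖β τ‖ ≤ βmax) (hsmall : βmax ≤ G)
    (hgain : ∀ τ ∈ Icc c b, β₀ ≤ -(α τ).re
      - (βmax / (2 * G)) / (1 - βmax / (2 * G)) * (2 * |(α τ).im| + βmax / (2 * G) * ‖β τ‖)
      - (w τ * ‖β' τ‖ / (2 * G)) / (1 - βmax / (2 * G)))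
    (hstag : β₀ ≤ G - ‖α c‖ - ‖β c‖) :
    ∀ τ ∈ Icc c b, ‖z τ‖ ≤ ((1 + βmax / (2 * G)) * M / β₀) / (1 - βmax / (2 * G)) := by
  have hk0 : 0 ≤ βmax / (2 * G) := by positivity
  have hk1 : βmax / (2 * G) ≤ 1 / 2 := by rw [div_le_iff₀ (by positivity)]; linarith
  have h1k : 0 < 1 - βmax / (2 * G) := by linarith
  have h1k' : 0 < 1 + βmax / (2 * G) := by linarith
  have hK : M / β₀ ≤ ((1 + βmax / (2 * G)) * M / β₀) / (1 - βmax / (2 * G)) := by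
    rw [le_div_iff₀ h1k]
    have h0 : 0 ≤ M / β₀ := by positivity
    have e : (1 + βmax / (2 * G)) * M / β₀ = M / β₀ * (1 + βmax / (2 * G)) := by ring
    rw [e]; nlinarith
  have hph : ∀ r : ℝ, ‖cexp (-I * (r : ℂ))‖ = 1 := fun r => by rw [Complex.norm_exp]; simp
  intro τ hτ
  have hc : c ∈ Icc c b := left_mem_Icc.2 (hτ.1.trans hτ.2)
  have hzc : ‖z c‖ ≤ M / β₀ := by
    have h := hode c hc
    rw [hwc, Complex.ofReal_zero, zero_mul] at h
    have h1 := norm_le_of_stagnation_rot hG h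
    have h2 : β₀ * ‖z c‖ ≤ M := by nlinarith [norm_nonneg (z c), hf c hc]
    rw [le_div_iff₀ hβ₀]; linarith
  rcases eq_or_lt_of_le hτ.1 with h | hcτ
  · rw [← h]; exact hzc.trans hK
  rw [le_iff_forall_pos_le_add]
  intro ε hε
  set ε' : ℝ := ε * (1 - βmax / (2 * G)) / (1 + βmax / (2 * G)) with hε'
  have hε'0 : 0 < ε' := by positivity
  obtain ⟨δ, hδ, hδz⟩ := Metric.continuousAt_iff.1 (hz c hc).continuousAt ε' hε'0
  set a : ℝ := min τ (c + δ / 2) with ha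
  have hca : c < a := lt_min hcτ (by linarith)
  have haτ : a ≤ τ := min_le_left _ _
  have hdist : dist a c < δ := by
    rw [Real.dist_eq, abs_of_pos (by linarith)]
    have : a ≤ c + δ / 2 := min_le_right _ _
    linarith
  have hza : ‖z a‖ ≤ (M + β₀ * ε') / β₀ := by
    have h1 : ‖z a - z c‖ < ε' := by rw [← dist_eq_norm]; exact hδz hdist
    calc ‖z a‖ = ‖z c + (z a - z c)‖ := by rw [add_sub_cancel]
      _ ≤ ‖z c‖ + ‖z a - z c‖ := norm_add_le _ _
      _ ≤ M / β₀ + ε' := add_le_add hzc h1.le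
      _ = (M + β₀ * ε') / β₀ := by field_simp
  have hsub : Icc a b ⊆ Icc c b := Icc_subset_Icc hca.le le_rfl
  have hwpos : ∀ t ∈ Icc a b, 0 < w t := fun t ht => hw t ⟨lt_of_lt_of_le hca ht.1, ht.2⟩
  have hθ := hasDerivAt_phase_integral (G := G) (a := a) (b := b) hwcont hwpos
  have hwθ : ∀ t ∈ Icc a b, w t * (G / w t) = G := fun t ht => mul_div_cancel₀ G (hwpos t ht).ne'
  have hrot := fun t (ht : t ∈ Icc a b) =>
    rotatingFrame (α := α t) (β := β t) (hz t (hsub ht)) (hθ t ht) (hwθ t ht) (hode t (hsub ht))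
  have hg : ∀ t ∈ Icc a b, ‖cexp (-I * ((∫ s in a..t, G / w s : ℝ) : ℂ)) * f t‖ ≤ M + β₀ * ε' := by
    intro t ht
    rw [norm_mul, hph, one_mul]
    have := hf t (hsub ht)
    nlinarith
  have hua : ‖cexp (-I * ((∫ s in a..a, G / w s : ℝ) : ℂ)) * z a‖ ≤ (M + β₀ * ε') / β₀ := by
    rw [norm_mul, hph, one_mul]; exact hza
  have hfence := farBranch_norm_le_of_damped_var (a := a) (b := b)
    (u := fun r => cexp (-I * ((∫ s in a..r, G / w s : ℝ) : ℂ)) * z r)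
    (u' := fun t => cexp (-I * ((∫ s in a..t, G / w s : ℝ) : ℂ)) * (-I * ((G / w t : ℝ) : ℂ)) * z t
      + cexp (-I * ((∫ s in a..t, G / w s : ℝ) : ℂ)) * z' t)
    (g := fun t => cexp (-I * ((∫ s in a..t, G / w s : ℝ) : ℂ)) * f t)
    (θ := fun r => ∫ s in a..r, G / w s) (θ' := fun t => G / w t)
    hG (by positivity : 0 ≤ M + β₀ * ε') hβ₀ hβmax0 (fun t ht => (hrot t ht).1) hθ (fun t ht => hβ t (hsub ht)) hwpos hwθ
    (fun t ht => (hrot t ht).2) hg (fun t ht => hβmax t (hsub ht)) hsmall (fun t ht => hgain t (hsub ht)) hua τ ⟨haτ, hτ.2⟩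
  have hzu : ‖z τ‖ = ‖cexp (-I * ((∫ s in a..τ, G / w s : ℝ) : ℂ)) * z τ‖ := by rw [norm_mul, hph, one_mul]
  rw [hzu]
  have hden1 : G * 2 - βmax ≠ 0 := ne_of_gt (by linarith)
  have hden2 : G * 2 + βmax ≠ 0 := ne_of_gt (by linarith)
  have hden3 : 2 * G - βmax ≠ 0 := ne_of_gt (by linarith)
  have hden4 : 2 * G + βmax ≠ 0 := ne_of_gt (by linarith)
  calc _ ≤ ((1 + βmax / (2 * G)) * (M + β₀ * ε') / β₀) / (1 - βmax / (2 * G)) := hfence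
    _ = ((1 + βmax / (2 * G)) * M / β₀) / (1 - βmax / (2 * G)) + ε := by
        rw [hε']; field_simp

/-! ## §2 The amplified zone, outward with the weight, variable coefficients -/

/-- ★ **WEIGHTED OUTWARD TRANSPORT, variable `α(τ), β(τ)`.**  `w·z′ = iG z + α z + β z̄ + f` on `[a, b]`, `c < a`, `w` continuous,
`w τ ≥ w₁(τ−c)` (`w₁ > 0`), `β ∈ C¹`, `‖β‖ ≤ βmax ≤ G`, `‖f‖ ≤ M`, `‖z a‖ ≤ M/β₀`, and `p ≥ 0` with, pointwise,
`Re α(τ) + β₀ + (k/(1−k))(2|Im α(τ)| + k‖β τ‖) + (w τ‖β′ τ‖/(2G))/(1−k) ≤ p·w₁`.  Then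
`‖z τ‖ ≤ ((τ−c)/(a−c))^p·((1+k)M/β₀)/(1−k)` on `[a, b]`. [folklore] -/
theorem farBranch_norm_le_weighted_var {z z' f α β β' : ℝ → ℂ} {w : ℝ → ℝ} {a b c G M β₀ βmax w₁ p : ℝ}
    (hG : 0 < G) (hM : 0 ≤ M) (hβ₀ : 0 < β₀) (hβmax0 : 0 ≤ βmax) (hca : c < a) (hw₁ : 0 < w₁) (hp0 : 0 ≤ p)
    (hz : ∀ τ ∈ Icc a b, HasDerivAt z (z' τ) τ) (hβ : ∀ τ ∈ Icc a b, HasDerivAt β (β' τ) τ)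
    (hwcont : Continuous w) (hw : ∀ τ ∈ Icc a b, w₁ * (τ - c) ≤ w τ)
    (hode : ∀ τ ∈ Icc a b, (w τ : ℂ) * z' τ = I * G * z τ + α τ * z τ + β τ * conj (z τ) + f τ)
    (hf : ∀ τ ∈ Icc a b, ‖f τ‖ ≤ M) (hβmax : ∀ τ ∈ Icc a b, ‖β τ‖ ≤ βmax) (hsmall : βmax ≤ G)
    (hgain : ∀ τ ∈ Icc a b, (α τ).re + β₀ + (βmax / (2 * G)) / (1 - βmax / (2 * G)) * (2 * |(α τ).im| + βmax / (2 * G) * ‖β τ‖)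
      + (w τ * ‖β' τ‖ / (2 * G)) / (1 - βmax / (2 * G)) ≤ p * w₁)
    (ha : ‖z a‖ ≤ M / β₀) :
    ∀ τ ∈ Icc a b, ‖z τ‖ ≤ ((τ - c) / (a - c)) ^ p * (((1 + βmax / (2 * G)) * M / β₀) / (1 - βmax / (2 * G))) := by
  have hac : 0 < a - c := by linarith
  have hwpos : ∀ t ∈ Icc a b, 0 < w t := fun t ht => lt_of_lt_of_le (by nlinarith [ht.1]) (hw t ht)
  have hθ := hasDerivAt_phase_integral (G := G) (a := a) (b := b) hwcont hwpos
  set θ : ℝ → ℝ := fun r => ∫ s in a..r, G / w s with hθdef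
  have hwθ : ∀ t ∈ Icc a b, w t * (G / w t) = G := fun t ht => mul_div_cancel₀ G (hwpos t ht).ne'
  set u : ℝ → ℂ := fun r => cexp (-I * (θ r : ℂ)) * z r with hudef
  set u' : ℝ → ℂ := fun t => cexp (-I * (θ t : ℂ)) * (-I * ((G / w t : ℝ) : ℂ)) * z t + cexp (-I * (θ t : ℂ)) * z' t with hu'def
  have hrot : ∀ t ∈ Icc a b, HasDerivAt u (u' t) t ∧
      (w t : ℂ) * u' t = α t * u t + β t * cexp (-2 * I * (θ t : ℂ)) * conj (u t) + cexp (-I * (θ t : ℂ)) * f t :=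
    fun t ht => rotatingFrame (hz t ht) (hθ t ht) (hwθ t ht) (hode t ht)
  have hph : ∀ r : ℝ, ‖cexp (-I * (r : ℂ))‖ = 1 := fun r => by rw [Complex.norm_exp]; simp
  -- the weight
  set W : ℝ → ℝ := fun r => ((r - c) / (a - c)) ^ (-p) with hW
  have hWf : ∀ t ∈ Icc a b, 0 < W t ∧ W t ≤ 1 ∧ HasDerivAt W (-(p / (t - c)) * W t) t := by
    intro t ht
    have htc : 0 < t - c := by linarith [ht.1]
    have hρ : 0 < (t - c) / (a - c) := by positivity
    have hρ1 : 1 ≤ (t - c) / (a - c) := by rw [le_div_iff₀ hac]; linarith [ht.1]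
    refine ⟨Real.rpow_pos_of_pos hρ _, Real.rpow_le_one_of_one_le_of_nonpos hρ1 (by linarith), ?_⟩
    have h1 : HasDerivAt (fun r : ℝ => (r - c) / (a - c)) (1 / (a - c)) t := by
      simpa using ((hasDerivAt_id t).sub_const c).div_const (a - c)
    have h2 := h1.rpow_const (p := -p) (Or.inl hρ.ne')
    have e : 1 / (a - c) * (-p) * ((t - c) / (a - c)) ^ (-p - 1) = -(p / (t - c)) * ((t - c) / (a - c)) ^ (-p) := by
      rw [show (-p - 1 : ℝ) = -p + (-1) by ring, Real.rpow_add hρ, Real.rpow_neg_one]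
      field_simp
    rw [e] at h2
    exact h2
  set v : ℝ → ℂ := fun r => (W r : ℂ) * u r with hvdef
  set v' : ℝ → ℂ := fun t => ((-(p / (t - c)) * W t : ℝ) : ℂ) * u t + (W t : ℂ) * u' t with hv'def
  have hvder : ∀ t ∈ Icc a b, HasDerivAt v (v' t) t :=
    fun t ht => ((hWf t ht).2.2.ofReal_comp).mul ((hrot t ht).1)
  set αv : ℝ → ℂ := fun t => α t - ((p * w t / (t - c) : ℝ) : ℂ) with hαv
  set g : ℝ → ℂ := fun t => (W t : ℂ) * (cexp (-I * (θ t : ℂ)) * f t) with hgdef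
  have hodev : ∀ t ∈ Icc a b, (w t : ℂ) * v' t = αv t * v t + β t * cexp (-2 * I * (θ t : ℂ)) * conj (v t) + g t := by
    intro t ht
    have htc : (t - c) ≠ 0 := by have := ht.1; linarith
    have h := (hrot t ht).2
    simp only [hv'def, hvdef, hαv, hgdef, map_mul, Complex.conj_ofReal]
    have e1 : (w t : ℂ) * ((((-(p / (t - c)) * W t : ℝ) : ℂ)) * u t + (W t : ℂ) * u' t)
        = (W t : ℂ) * ((w t : ℂ) * u' t) - ((p * w t / (t - c) : ℝ) : ℂ) * ((W t : ℂ) * u t) := by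
      push_cast
      field_simp
      ring
    rw [e1, h]
    ring
  have hg : ∀ t ∈ Icc a b, ‖g t‖ ≤ M := by
    intro t ht
    simp only [hgdef]
    rw [norm_mul, norm_mul, hph, one_mul, Complex.norm_real, Real.norm_eq_abs, abs_of_pos (hWf t ht).1]
    calc W t * ‖f t‖ ≤ 1 * M := mul_le_mul (hWf t ht).2.1 (hf t ht) (norm_nonneg _) zero_le_one
      _ = M := one_mul M
  have hgain' : ∀ t ∈ Icc a b, β₀ ≤ -(αv t).re
      - (βmax / (2 * G)) / (1 - βmax / (2 * G)) * (2 * |(αv t).im| + βmax / (2 * G) * ‖β t‖)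
      - (w t * ‖β' t‖ / (2 * G)) / (1 - βmax / (2 * G)) := by
    intro t ht
    have htc : 0 < t - c := by linarith [ht.1]
    have hre : (αv t).re = (α t).re - p * w t / (t - c) := by simp only [hαv, Complex.sub_re, Complex.ofReal_re]
    have him : (αv t).im = (α t).im := by simp only [hαv, Complex.sub_im, Complex.ofReal_im, sub_zero]
    rw [hre, him]
    have h3 : p * w₁ ≤ p * w t / (t - c) := by
      rw [le_div_iff₀ htc]; nlinarith [hw t ht, hp0]
    linarith [hgain t ht]
  have hWa : W a = 1 := by simp only [hW]; rw [div_self hac.ne', Real.one_rpow]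
  have hva : ‖v a‖ ≤ M / β₀ := by
    simp only [hvdef, hudef]; rw [hWa, norm_mul, norm_mul, hph, Complex.ofReal_one, norm_one, one_mul, one_mul]; exact ha
  have hfence := farBranch_norm_le_of_damped_var hG hM hβ₀ hβmax0 hvder hθ hβ hwpos hwθ hodev hg hβmax hsmall hgain' hva
  intro τ hτ
  have hWτ := (hWf τ hτ).1
  have hρpos : 0 < (τ - c) / (a - c) := div_pos (by linarith [hτ.1]) hac
  have hzτ : ‖z τ‖ = ((τ - c) / (a - c)) ^ p * ‖v τ‖ := by
    simp only [hvdef, hudef]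
    rw [norm_mul, norm_mul, hph, one_mul, Complex.norm_real, Real.norm_eq_abs, abs_of_pos hWτ, ← mul_assoc, hW,
      ← Real.rpow_add hρpos, add_neg_cancel, Real.rpow_zero, one_mul]
  rw [hzτ]
  exact mul_le_mul_of_nonneg_left (hfence τ hτ) (Real.rpow_nonneg hρpos.le _)

end Summit.NavierStokesRegularity.NavierStokesRegularity.Theorems.Clause13Transport
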